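import Literature.MathematicalPhysics.QuantumFieldTheory.Balaban1983to89.B15AveragingHolomorphic
import Literature.MathematicalPhysics.QuantumFieldTheory.Balaban1983to89.Node00.AveragingTwoBlockWindow

/-!
# `Balaban1983to89.B15AveragingHolomorphicLocal` — [Balaban1987RG1] = «[I]», (0.4) p. 253; [Balaban1985Variational] = «[15]», Sect. G p. 307, Prop. 9 (190) p. 309:
# THE HOLOMORPHIC AVERAGING IS TWO-BLOCK LOCAL, AND ITS ITERATE IS ℂ-DIFFERENTIABLE AT A BOND UNDER THE (0.4) GUARD ALONG THAT BOND's TOWER ONLY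

Honest framing: statement-level skeleton of published theorems with citation tags; proofs where landed; nothing here is a claim about the
Yang–Mills mass gap.  Cell `pub-ymgap`, HUMAN RULING D-0062 (Track A), seat `pub-ymgap-dag-n12-c` g23 (lane owner N12 = [B15], strategy s1; lane memo
`N12-UNIFORMITY-SPEC.md` §6 «LOCATED-E1-HSB», repair step (r1)); count-neutral; N12 NOT discharged; finite 𝕋⁴ at fixed ε; nothing continuum ∕ OS ∕ mass-gap ∕ Clay.

WHY.  `B15AveragingHolomorphic.differentiableAt_iterMh(_entry)` proves ℂ-differentiability of the holomorphic `k`-fold average `iterMh k` at `↑U` under the GLOBAL (0.4) guard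
`SmallBelow av k U` — the guard at EVERY coarse bond of the torus at every level `< k`.  The N12 producer of the analytic letter (J0′) (w1 lineage:
`B15Prop1DatumCoordinates` → … → `hMin_atRecord_of_node00Letters_thm1AtBase_central`) therefore displays `SmallBelow` for the datum's pull-back AND for the base minimiser — false for
data rough off `Z`, the regime [Balaban1989LargeFieldI] Prop. 1 exists for (lane memo §6).  But the implicit-function argument reads `iterMh j (·) c` ONLY at the constrained bonds `c`,
and (0.4) is TWO-BLOCK LOCAL: `Ū(c)` reads the field only on bonds with both ends in `B(c₋) ∪ B(c₊)` (`T4ReflectionConeSharp.avgFun_congr₂`, there for the group-valued averaging).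
THIS MODULE is the matrix∕holomorphic twin and its iterate along a block-saturated fine region `Y` (`Node00.AveragingTwoBlockWindow`'s framework): `iterMh k V c` for `c ∈ bondsIn k Y`
reads `V` only on `bondsIn 0 Y`, and `V ↦ iterMh k V c` is ℂ-differentiable at any `V₀` that agrees on `bondsIn 0 Y` with `↑U` for an `SU(N)` field `U` guarded ONLY at the bonds of
`Y` (`∀ j < k, ∀ c′ ∈ bondsIn (j+1) Y, Small (Ū^j U) c′`) — the per-tower guard a (2.12) minimiser's CLASS supplies on its constraint towers (the lane's ρ5b proxies), with no
condition off `Y`.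

CONTENTS (theorems only; no `def`, no `instance`, no `sorry`; axioms standard).
§1 `stepMh_congr` · `holMh_congr` (a walk product reads the field on the walk's bonds) · `eq_line_of_mem_walk_replicate` (the steps of the straight walk of `c` are the bonds `line c t`, `t < L`).
§2 `loopMh_congr₂` · `axialMh_congr₂` · ★ `avgMh_apply_congr₂` (two-block locality of the holomorphic (0.4)) · `avgMh_apply_congr_of_eqOn_bondsIn` (on a saturated region).
§3 `differentiableAt_avgMh_apply` (ONE coarse bond: the polydisc condition at `c` only) · ★ `differentiableAt_avgMh_apply_of_eqOn₂_coeField` (at any field matching a `c`-guarded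
   `SU(N)` field on the two-block window of `c`).
§4 Towers on a saturated region `Y` (`hY : ∀ j < k, ∀ s, toFine j s ∈ Y ↔ toFine (j+1) (blockOf s) ∈ Y`): ★ `iterMh_apply_congr_of_eqOn_bondsIn` · ★ `iterMh_coeField_apply_eq_of_guardOn`
   (`iterMh k ↑U c = ↑(Ū^k U)(c)` on `bondsIn k Y` under the guard on `Y` only) · ★★★ `differentiableAt_iterMh_apply_of_guardOn` · `differentiableAt_iterMh_apply_entry_of_guardOn`
   (entrywise, along a ℂ-differentiable family — the shape the (J0′) producer consumes) · `differentiableAt_iterMh_apply_of_proxy` (global guard on a PROXY agreeing with `V₀` on `Y`).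
HONEST SCOPE: lattice∕calculus bookkeeping over landed definitions ([folklore]; the (0.4) cites are locators); the saturation of `Y` and the per-tower guard are DISPLAYED; nothing of
Bałaban's estimates; N12 NOT discharged; the YM mass gap (Clay) is NOT proved by any of this — R4 closes only the conditional finite-𝕋⁴ rung `BalabanLadder.UV`.
-/

noncomputable section

namespace Literature.MathematicalPhysics.QuantumFieldTheory.Balaban1983to89.B15AveragingHolomorphicLocal

open Literature.MathematicalPhysics.QuantumFieldTheory.Balaban1983to89.Node00
  (SU coeField coeField_apply avgM SmallBelow coe_avgFun_of_small norm_loopM_coeField_sub_one_lt_one)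
open T4Continuum BlockAveraging B15DeterminingSets B15AveragingHolomorphic
open ExpMeanLog (eml expMeanLogSU analyticAt_eml)
open B10Eq42TorusConstraint (bondsIn mem_bondsIn_iff)
open B10Eq38TorusDomains (toFine)
open scoped Matrix.Norms.L2Operator

/-! ## §1  Walk products read the field on the walk's bonds -/

section Walks

variable {P : Params} {j : ℕ} {N : ℕ}

/-- A holomorphic step matrix reads the field at the step's bond only. [cite: Balaban1987RG1, (0.4) p.253 (bookkeeping)] -/
theorem stepMh_congr {V V' : PBond P j → Matrix (Fin N) (Fin N) ℂ} {s : LStep P j} (h : V s.bond = V' s.bond) : stepMh V s = stepMh V' s := by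
  unfold stepMh
  rw [h]

/-- A holomorphic walk product reads the field on the walk's bonds only. [cite: Balaban1987RG1, (0.4) p.253 (bookkeeping)] -/
theorem holMh_congr {V V' : PBond P j → Matrix (Fin N) (Fin N) ℂ} :
    ∀ {γ : List (LStep P j)}, (∀ s ∈ γ, V s.bond = V' s.bond) → holMh V γ = holMh V' γ
  | [], _ => by rw [holMh_nil, holMh_nil]
  | s :: γ, h => by
    rw [holMh_cons, holMh_cons, stepMh_congr (h s (List.mem_cons_self)), holMh_congr fun s' hs' => h s' (List.mem_cons_of_mem _ hs')]

/-- The steps of the straight walk of `n` letters `+e_{μ(c)}` from `emb c₋` are the bonds `line c t`, `t < n`, traversed forward (`BlockAveraging.walkEnd_replicate_line`).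
[cite: Balaban1984PropagatorsI, (1.7) p.18 (bookkeeping)] -/
theorem eq_line_of_mem_walk_replicate (c : PBond P (j + 1)) :
    ∀ (n : ℕ) (s : LStep P j), s ∈ walk (emb c.src) (List.replicate n (c.dir, true)) → ∃ t, t < n ∧ s = ⟨AveragingRT.line c t, true⟩
  | 0, s, hs => by simp [walk] at hs
  | n + 1, s, hs => by
    rw [List.replicate_succ', walk_append, List.mem_append, walkEnd_replicate_line] at hs
    rcases hs with hs | hs
    · obtain ⟨t, ht, hts⟩ := eq_line_of_mem_walk_replicate c n s hs
      exact ⟨t, Nat.lt_succ_of_lt ht, hts⟩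
    · refine ⟨n, Nat.lt_succ_self n, ?_⟩
      simp only [walk, List.mem_cons, List.not_mem_nil, or_false] at hs
      rw [hs]
      rfl

end Walks

/-! ## §2  The holomorphic (0.4) is two-block local -/

section Window

variable {P : Params} {j : ℕ} {N : ℕ}

/-- The holomorphic loop matrices at `c` read the field only on bonds with both ends in `B(c₋) ∪ B(c₊)` (`BlockAveraging.blockOf_src_of_mem_walk`,
`T4ReflectionConeSharp.blockOf_tgt_of_mem_walk`). [cite: Balaban1987RG1, (0.4) p.253] -/
theorem loopMh_congr₂ (hj : j + 1 ≤ P.m + P.K) {V V' : PBond P j → Matrix (Fin N) (Fin N) ℂ} (c : PBond P (j + 1))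
    (hVV' : ∀ b : PBond P j, (blockOf b.src = c.src ∨ blockOf b.src = c.tgt) → (blockOf b.tgt = c.src ∨ blockOf b.tgt = c.tgt) → V b = V' b)
    (i : Idx P) : loopMh V c i = loopMh V' c i :=
  holMh_congr fun s hs => hVV' s.bond (blockOf_src_of_mem_walk hj c i s hs) (T4ReflectionConeSharp.blockOf_tgt_of_mem_walk hj c i s hs)

/-- The holomorphic straight transporter at `c` reads the field only on bonds with both ends in `B(c₋) ∪ B(c₊)` (`AveragingRT.blockOf_lineSite`, `T4ReflectionConeSharp.blockOf_tgt_line`).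
[cite: Balaban1984PropagatorsI, (1.7) p.18] -/
theorem axialMh_congr₂ (hj : j + 1 ≤ P.m + P.K) {V V' : PBond P j → Matrix (Fin N) (Fin N) ℂ} (c : PBond P (j + 1))
    (hVV' : ∀ b : PBond P j, (blockOf b.src = c.src ∨ blockOf b.src = c.tgt) → (blockOf b.tgt = c.src ∨ blockOf b.tgt = c.tgt) → V b = V' b) :
    axialMh V c = axialMh V' c :=
  holMh_congr fun s hs => by
    obtain ⟨t, ht, rfl⟩ := eq_line_of_mem_walk_replicate c P.L s hs
    exact hVV' _ (AveragingRT.blockOf_lineSite hj c ht) (T4ReflectionConeSharp.blockOf_tgt_line hj c ht)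

/-- ★ **THE HOLOMORPHIC (0.4) IS TWO-BLOCK LOCAL**: `avgMh V c` reads `V` only on the bonds with both ends in `B(c₋) ∪ B(c₊)` — the matrix twin of `T4ReflectionConeSharp.avgFun_congr₂`.
[cite: Balaban1987RG1, (0.4) p.253] -/
theorem avgMh_apply_congr₂ (hj : j + 1 ≤ P.m + P.K) {V V' : PBond P j → Matrix (Fin N) (Fin N) ℂ} (c : PBond P (j + 1))
    (hVV' : ∀ b : PBond P j, (blockOf b.src = c.src ∨ blockOf b.src = c.tgt) → (blockOf b.tgt = c.src ∨ blockOf b.tgt = c.tgt) → V b = V' b) :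
    avgMh V c = avgMh V' c := by
  have hl : (fun i : Idx P => loopMh V c i) = fun i => loopMh V' c i := funext fun i => loopMh_congr₂ hj c hVV' i
  show eml (fun i : Idx P => loopMh V c i) * axialMh V c = eml (fun i : Idx P => loopMh V' c i) * axialMh V' c
  rw [hl, axialMh_congr₂ hj c hVV']

/-- On a fine region `Y` SATURATED at level `j+1` (`hY`), two level-`j` matrix fields agreeing on `bondsIn j Y` have the same holomorphic average at every bond of `bondsIn (j+1) Y`
— the matrix twin of `Node00.avgFun_congr_of_eqOn_bondsIn`. [cite: Balaban1987RG1, (0.4) p.253 (bookkeeping)] -/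
theorem avgMh_apply_congr_of_eqOn_bondsIn (hj : j + 1 ≤ P.m + P.K) {Y : Set (Site P 0)}
    (hY : ∀ s : Site P j, toFine j s ∈ Y ↔ toFine (j + 1) (blockOf s) ∈ Y)
    {V V' : PBond P j → Matrix (Fin N) (Fin N) ℂ} (hVV' : ∀ b : PBond P j, b ∈ bondsIn j Y → V b = V' b)
    {c : PBond P (j + 1)} (hc : c ∈ bondsIn (j + 1) Y) : avgMh V c = avgMh V' c := by
  rw [mem_bondsIn_iff] at hc
  have hblk : ∀ x : Site P j, (blockOf x = c.src ∨ blockOf x = c.tgt) → toFine j x ∈ Y := by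
    intro x hx
    refine (hY x).2 ?_
    rcases hx with h | h
    · rw [h]; exact hc.1
    · rw [h]; exact hc.2
  refine avgMh_apply_congr₂ hj c fun b h₁ h₂ => hVV' b ?_
  rw [mem_bondsIn_iff]
  exact ⟨hblk _ h₁, hblk _ h₂⟩

end Window

/-! ## §3  ℂ-differentiability of the holomorphic (0.4) at ONE coarse bond -/

section OneBond

variable {P : Params} {j : ℕ} {N : ℕ}

/-- **ONE COARSE BOND**: `V ↦ avgMh V c` is ℂ-differentiable at `V₀` as soon as the loop matrices AT `c` lie in the polydisc `‖W − 1‖ < 1` (the per-bond form of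
`B15AveragingHolomorphic.differentiableAt_avgMh`, whose hypothesis asks it at every coarse bond). [cite: Balaban1987RG1, (0.4) p.253 («analytic function»); Balaban1985Variational, Prop. 9 p.309] -/
theorem differentiableAt_avgMh_apply {V₀ : PBond P j → Matrix (Fin N) (Fin N) ℂ} (c : PBond P (j + 1)) (h : ∀ i : Idx P, ‖loopMh V₀ c i - 1‖ < 1) :
    DifferentiableAt ℂ (fun V : PBond P j → Matrix (Fin N) (Fin N) ℂ => avgMh V c) V₀ := by
  have hin : DifferentiableAt ℂ (fun V : PBond P j → Matrix (Fin N) (Fin N) ℂ => fun i : Idx P => loopMh V c i) V₀ :=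
    differentiableAt_pi.2 fun i => (differentiable_holMh _) V₀
  have heml : DifferentiableAt ℂ (eml : (Idx P → Matrix (Fin N) (Fin N) ℂ) → Matrix (Fin N) (Fin N) ℂ) (fun i => loopMh V₀ c i) :=
    (analyticAt_eml (𝔸 := Matrix (Fin N) (Fin N) ℂ) h).differentiableAt
  have hcorr : DifferentiableAt ℂ (fun V : PBond P j → Matrix (Fin N) (Fin N) ℂ => corrMh V c) V₀ := heml.comp V₀ hin
  exact hcorr.mul ((differentiable_holMh _) V₀)

/-- ★ **ONE COARSE BOND, GUARD READ OFF A MATCHING `SU(N)` FIELD ON THE TWO-BLOCK WINDOW**: if `V₀` agrees with `↑U` on the bonds with both ends in `B(c₋) ∪ B(c₊)` and `U` is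
(0.4)-small AT `c`, then `V ↦ avgMh V c` is ℂ-differentiable at `V₀` (the loop matrices at `c` are those of `↑U`, in the polydisc by `Node00.norm_loopM_coeField_sub_one_lt_one`).
No condition on `V₀` or `U` away from the window. [cite: Balaban1987RG1, (0.4) p.253; Balaban1985Variational, Prop. 9 p.309] -/
theorem differentiableAt_avgMh_apply_of_eqOn₂_coeField [NeZero N] (hj : j + 1 ≤ P.m + P.K) {V₀ : PBond P j → Matrix (Fin N) (Fin N) ℂ} {U : GaugeField P j (SU N)}
    (c : PBond P (j + 1))
    (hV₀ : ∀ b : PBond P j, (blockOf b.src = c.src ∨ blockOf b.src = c.tgt) → (blockOf b.tgt = c.src ∨ blockOf b.tgt = c.tgt) → V₀ b = coeField U b)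
    (hU : Small expMeanLogSU U c) :
    DifferentiableAt ℂ (fun V : PBond P j → Matrix (Fin N) (Fin N) ℂ => avgMh V c) V₀ :=
  differentiableAt_avgMh_apply c fun i => by
    rw [loopMh_congr₂ hj c hV₀ i, loopMh_coeField]
    exact norm_loopM_coeField_sub_one_lt_one U c hU i

end OneBond

/-! ## §4  Towers: the holomorphic iterate at a bond of a saturated region reads, and is differentiable under the guard on, that region only -/

section Tower

variable {P : Params} {N : ℕ}

/-- ★ **THE HOLOMORPHIC ITERATE ON A SATURATED REGION READS THE REGION ONLY**: if the fine region `Y` is saturated at every level `< k` (`hY`), two level-`0` matrix fields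
agreeing on `bondsIn 0 Y` have the same `iterMh k` at every bond of `bondsIn k Y` (induction on §2's one-step window). [cite: Balaban1987RG1, (0.4) p.253, (0.21) p.256 (bookkeeping)] -/
theorem iterMh_apply_congr_of_eqOn_bondsIn {Y : Set (Site P 0)} :
    ∀ (k : ℕ), k ≤ P.m + P.K → (∀ j, j < k → ∀ s : Site P j, toFine j s ∈ Y ↔ toFine (j + 1) (blockOf s) ∈ Y) →
      ∀ {V V' : PBond P 0 → Matrix (Fin N) (Fin N) ℂ}, (∀ b : PBond P 0, b ∈ bondsIn 0 Y → V b = V' b) →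
        ∀ c : PBond P k, c ∈ bondsIn k Y → iterMh k V c = iterMh k V' c
  | 0, _, _, _, _, hVV', c, hc => by simpa only [iterMh_zero] using hVV' c hc
  | k + 1, hk, hY, _, _, hVV', c, hc => by
    rw [iterMh_succ, iterMh_succ]
    exact avgMh_apply_congr_of_eqOn_bondsIn hk (hY k (Nat.lt_succ_self k))
      (fun b hb => iterMh_apply_congr_of_eqOn_bondsIn k (Nat.le_of_succ_le hk) (fun j hj => hY j (Nat.lt_succ_of_lt hj)) hVV' b hb) hc

variable [NeZero N]

/-- ★ **UNDER THE GUARD ON THE REGION ONLY, THE HOLOMORPHIC ITERATE OF `↑U` IS THE MATRIX OF `Ū^k U` ON THE REGION**: with `Y` saturated below `k` and `U` (0.4)-small at the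
bonds of `bondsIn (j+1) Y` of every level `j < k` (NO condition off `Y`), `iterMh k ↑U c = ↑((Ū^k U)(c))` for `c ∈ bondsIn k Y` (the per-region form of
`B15AveragingHolomorphic.coeField_iter_eq_iterMh`). [cite: Balaban1987RG1, (0.4) p.253, (0.21) p.256] -/
theorem iterMh_coeField_apply_eq_of_guardOn {Y : Set (Site P 0)} {U : GaugeField P 0 (SU N)} :
    ∀ (k : ℕ), k ≤ P.m + P.K → (∀ j, j < k → ∀ s : Site P j, toFine j s ∈ Y ↔ toFine (j + 1) (blockOf s) ∈ Y) →
      (∀ j, j < k → ∀ c : PBond P (j + 1), c ∈ bondsIn (j + 1) Y →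
        Small expMeanLogSU (Averaging.iter (fun j => blockAvg (P := P) (j := j) expMeanLogSU) j U) c) →
        ∀ c : PBond P k, c ∈ bondsIn k Y →
          iterMh k (coeField U) c = coeField (Averaging.iter (fun j => blockAvg (P := P) (j := j) expMeanLogSU) k U) c
  | 0, _, _, _, c, _ => by simp only [iterMh_zero]; rfl
  | k + 1, hk, hY, hg, c, hc => by
    rw [iterMh_succ]
    have h1 : avgMh (iterMh k (coeField U)) c =
        avgMh (coeField (Averaging.iter (fun j => blockAvg (P := P) (j := j) expMeanLogSU) k U)) c :=
      avgMh_apply_congr_of_eqOn_bondsIn hk (hY k (Nat.lt_succ_self k))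
        (fun b hb => iterMh_coeField_apply_eq_of_guardOn k (Nat.le_of_succ_le hk) (fun j hj => hY j (Nat.lt_succ_of_lt hj))
          (fun j hj => hg j (Nat.lt_succ_of_lt hj)) b hb) hc
    rw [h1, avgMh_coeField, ← coe_avgFun_of_small _ c (hg k (Nat.lt_succ_self k) c hc)]
    show _ = (((blockAvg expMeanLogSU).avg (Averaging.iter (fun j => blockAvg (P := P) (j := j) expMeanLogSU) k U) c : SU N) :
        Matrix (Fin N) (Fin N) ℂ)
    rw [BlockAveraging.blockAvg_avg]

/-- ★★★ **THE HOLOMORPHIC ITERATE IS ℂ-DIFFERENTIABLE AT A BOND OF A SATURATED REGION UNDER THE (0.4) GUARD ON THAT REGION ONLY.**  Let `Y ⊂ T_η` be saturated below `k`,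
`U` an `SU(N)` field (0.4)-small at the bonds of `bondsIn (j+1) Y` for every `j < k` — NOTHING asked off `Y` — and `V₀` a level-`0` matrix field agreeing with `↑U` on `bondsIn 0 Y`.
Then for every `c ∈ bondsIn k Y` the map `V ↦ iterMh k V c` is ℂ-differentiable at `V₀`.  (Induction: the iterate at `c` factors, for every `V`, through the SPLICE keeping the
components on `bondsIn k Y` and freezing the others at `↑(Ū^k U)` — §2 locality —; the splice of the iterate is differentiable at `V₀` componentwise by induction; at `V₀` it equals
`↑(Ū^k U)`, where §3 gives the one-step differentiability from the guard at `c`.)  This is the per-tower replacement of `B15AveragingHolomorphic.differentiableAt_iterMh` (global guard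
`SmallBelow`) that the N12 producer of (J0′) needs at the constrained bonds (lane memo §6 (r1)). [cite: Balaban1987RG1, (0.4) p.253 («analytic function»), (0.21) p.256; Balaban1985Variational, Prop. 9 (190) p.309] -/
theorem differentiableAt_iterMh_apply_of_guardOn {Y : Set (Site P 0)} {U : GaugeField P 0 (SU N)} :
    ∀ (k : ℕ), k ≤ P.m + P.K → (∀ j, j < k → ∀ s : Site P j, toFine j s ∈ Y ↔ toFine (j + 1) (blockOf s) ∈ Y) →
      (∀ j, j < k → ∀ c : PBond P (j + 1), c ∈ bondsIn (j + 1) Y →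
        Small expMeanLogSU (Averaging.iter (fun j => blockAvg (P := P) (j := j) expMeanLogSU) j U) c) →
        ∀ {V₀ : PBond P 0 → Matrix (Fin N) (Fin N) ℂ}, (∀ b : PBond P 0, b ∈ bondsIn 0 Y → V₀ b = coeField U b) →
          ∀ c : PBond P k, c ∈ bondsIn k Y → DifferentiableAt ℂ (fun V : PBond P 0 → Matrix (Fin N) (Fin N) ℂ => iterMh k V c) V₀
  | 0, _, _, _, V₀, _, c, _ => by
    simp only [iterMh_zero]
    exact differentiableAt_apply c V₀
  | k + 1, hk, hY, hg, V₀, hV₀, c, hc => by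
    classical
    have hk' : k ≤ P.m + P.K := Nat.le_of_succ_le hk
    have hY' : ∀ j, j < k → ∀ s : Site P j, toFine j s ∈ Y ↔ toFine (j + 1) (blockOf s) ∈ Y := fun j hj => hY j (Nat.lt_succ_of_lt hj)
    have hg' : ∀ j, j < k → ∀ c : PBond P (j + 1), c ∈ bondsIn (j + 1) Y →
        Small expMeanLogSU (Averaging.iter (fun j => blockAvg (P := P) (j := j) expMeanLogSU) j U) c := fun j hj => hg j (Nat.lt_succ_of_lt hj)
    -- the frozen values `↑(Ū^k U)` and the splice along `bondsIn k Y`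
    set W₀ : PBond P k → Matrix (Fin N) (Fin N) ℂ := coeField (Averaging.iter (fun j => blockAvg (P := P) (j := j) expMeanLogSU) k U) with hW₀
    set spl : (PBond P k → Matrix (Fin N) (Fin N) ℂ) → (PBond P k → Matrix (Fin N) (Fin N) ℂ) :=
      fun W b => if b ∈ bondsIn k Y then W b else W₀ b with hspl
    -- (a) the iterate at `c` factors through the splice, for EVERY `V` (two-block locality on the saturated region)
    have hfac : (fun V : PBond P 0 → Matrix (Fin N) (Fin N) ℂ => iterMh (k + 1) V c) = fun V => avgMh (spl (iterMh k V)) c := by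
      funext V
      rw [iterMh_succ]
      exact avgMh_apply_congr_of_eqOn_bondsIn hk (hY k (Nat.lt_succ_self k)) (fun b hb => by simp only [hspl, if_pos hb]) hc
    rw [hfac]
    -- (b) the splice of the iterate is differentiable at `V₀`: components on `Y` by induction, the others constant
    have hsplD : DifferentiableAt ℂ (fun V : PBond P 0 → Matrix (Fin N) (Fin N) ℂ => spl (iterMh k V)) V₀ := by
      refine differentiableAt_pi.2 fun b => ?_
      by_cases hb : b ∈ bondsIn k Y
      · simp only [hspl, if_pos hb]
        exact differentiableAt_iterMh_apply_of_guardOn k hk' hY' hg' hV₀ b hb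
      · simp only [hspl, if_neg hb]
        exact differentiableAt_const _
    -- (c) at `V₀` the spliced iterate IS `↑(Ū^k U)`: on `Y` by locality and the guard identity, off `Y` by construction
    have hall : spl (iterMh k V₀) = W₀ := by
      funext b
      by_cases hb : b ∈ bondsIn k Y
      · simp only [hspl, if_pos hb]
        rw [iterMh_apply_congr_of_eqOn_bondsIn k hk' hY' hV₀ b hb, hW₀]
        exact iterMh_coeField_apply_eq_of_guardOn k hk' hY' hg' b hb
      · simp only [hspl, if_neg hb]
    -- (d) one step at `↑(Ū^k U)` from the guard AT `c`
    have havg : DifferentiableAt ℂ (fun W : PBond P k → Matrix (Fin N) (Fin N) ℂ => avgMh W c) (spl (iterMh k V₀)) := by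
      rw [hall, hW₀]
      exact differentiableAt_avgMh_apply_of_eqOn₂_coeField hk c (fun b _ _ => rfl) (hg k (Nat.lt_succ_self k) c hc)
    exact havg.comp V₀ hsplD

/-- **ENTRYWISE CURRENCY** (the shape the (J0′) producer consumes, per-tower twin of `B15AveragingHolomorphic.differentiableAt_iterMh_entry`): along any map `V : X → (PBond P 0 → M_N(ℂ))`
ℂ-differentiable at `x` whose value at `x` agrees with `↑U` on `bondsIn 0 Y`, `Y` saturated below `k`, `U` guarded on `Y` below `k`: every entry `y ↦ iterMh k (V y) c a e`,
`c ∈ bondsIn k Y`, is ℂ-differentiable at `x`. [cite: Balaban1985Variational, Prop. 9 (190) p.309; Balaban1987RG1, (0.4) p.253] -/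
theorem differentiableAt_iterMh_apply_entry_of_guardOn {X : Type*} [NormedAddCommGroup X] [NormedSpace ℂ X] {Y : Set (Site P 0)} {U : GaugeField P 0 (SU N)}
    (k : ℕ) (hk : k ≤ P.m + P.K) (hY : ∀ j, j < k → ∀ s : Site P j, toFine j s ∈ Y ↔ toFine (j + 1) (blockOf s) ∈ Y)
    (hg : ∀ j, j < k → ∀ c : PBond P (j + 1), c ∈ bondsIn (j + 1) Y →
      Small expMeanLogSU (Averaging.iter (fun j => blockAvg (P := P) (j := j) expMeanLogSU) j U) c)
    {V : X → PBond P 0 → Matrix (Fin N) (Fin N) ℂ} {x : X} (hV : DifferentiableAt ℂ V x) (hx : ∀ b : PBond P 0, b ∈ bondsIn 0 Y → V x b = coeField U b)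
    (c : PBond P k) (hc : c ∈ bondsIn k Y) (a e : Fin N) :
    DifferentiableAt ℂ (fun y => iterMh k (V y) c a e) x := by
  have h1 : DifferentiableAt ℂ (fun W : PBond P 0 → Matrix (Fin N) (Fin N) ℂ => iterMh k W c) (V x) :=
    differentiableAt_iterMh_apply_of_guardOn k hk hY hg hx c hc
  have h2 : DifferentiableAt ℂ (fun y => iterMh k (V y) c) x := h1.comp x hV
  exact differentiableAt_entry_of h2 a e

/-- **PROXY FORM**: if `V₀` agrees on `bondsIn 0 Y` with `↑U_p` for a GLOBALLY guarded proxy `U_p` (`SmallBelow … k U_p` — e.g. the lane's tower∕box proxies of a (2.12) minimiser,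
`N12TowerProxiesOfClass`), then `V ↦ iterMh k V c` is ℂ-differentiable at `V₀` for every `c ∈ bondsIn k Y` (the global guard of the proxy restricted to `Y`).
[cite: Balaban1987RG1, (0.4) p.253; Balaban1985Variational, Prop. 9 (190) p.309] -/
theorem differentiableAt_iterMh_apply_of_proxy {Y : Set (Site P 0)} {Up : GaugeField P 0 (SU N)} (k : ℕ) (hk : k ≤ P.m + P.K)
    (hY : ∀ j, j < k → ∀ s : Site P j, toFine j s ∈ Y ↔ toFine (j + 1) (blockOf s) ∈ Y)
    (hUp : SmallBelow (fun j => blockAvg (P := P) (j := j) expMeanLogSU) k Up)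
    {V₀ : PBond P 0 → Matrix (Fin N) (Fin N) ℂ} (hV₀ : ∀ b : PBond P 0, b ∈ bondsIn 0 Y → V₀ b = coeField Up b)
    (c : PBond P k) (hc : c ∈ bondsIn k Y) :
    DifferentiableAt ℂ (fun V : PBond P 0 → Matrix (Fin N) (Fin N) ℂ => iterMh k V c) V₀ :=
  differentiableAt_iterMh_apply_of_guardOn k hk hY (fun j hj c' _ => hUp j hj c') hV₀ c hc

end Tower

end Literature.MathematicalPhysics.QuantumFieldTheory.Balaban1983to89.B15AveragingHolomorphicLocal

end
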